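import Summits.MatrixMultiplication.OmegaCensus.DominoZ19StructSixArrC1
import Summits.MatrixMultiplication.OmegaCensus.DominoZ19StructSixArrC2
import Summits.MatrixMultiplication.OmegaCensus.DominoZ19StructSixArrC3v
import Summits.MatrixMultiplication.OmegaCensus.DominoZ19StructSixArrC4
import Summits.MatrixMultiplication.OmegaCensus.DominoZ19StructSixArrC5v
import Summits.MatrixMultiplication.OmegaCensus.DominoZ19StructSixArrC6
import HarnessLib

/-!
# The `y`-arrangement list of family `C` for the structural part-`6` route, `p = 19`: assembly

ω-census `pub-omega`, family (b3), seat pub-omega-group gen 25.  Framing: lottery ticket; floor = certified bounds/negative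
ranges.  VALUE: per-prime kernel data of the structural part-`6` route WITHOUT the pigeonhole (`DominoZpZpStructSixWide*.lean`)
for `p = 19` — target: the OPEN census cell `(1,6,20)@361` (`A = ℤ₁₉²`) and every larger order with such a quotient; NOT progress on ω.

`hyscZ19s6` (hypothesis `hYSc` of `exists_entry_structSixWide_of_checks`) from the per-representative decides.
-/

namespace Summit.MatrixMultiplication.OmegaCensus

open ZpZpDomino

namespace ZpZpDomino

/-- **Completeness of `yscZ19s6`**: every `arr6Y2`-arrangement of every representative that passes `dY6` is listed. [folklore] -/
theorem hyscZ19s6 : ∀ k ∈ rZ19s6, ∀ ys ∈ arr6Y2 19 k, dY6 ys = true → ys ∈ yscZ19s6 := by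
  have h : ∀ k ∈ rZ19s6, ((arr6Y2 19 k).all fun ys => !(dY6 ys) || yscZ19s6.contains ys) = true := by
    simp only [rZ19s6, List.forall_mem_cons]
    exact ⟨yscZ19s6_c0, yscZ19s6_c1, yscZ19s6_c2, yscZ19s6_c3, yscZ19s6_c4, yscZ19s6_c5, yscZ19s6_c6, yscZ19s6_c7, yscZ19s6_c8, yscZ19s6_c9, yscZ19s6_c10, yscZ19s6_c11, yscZ19s6_c12, yscZ19s6_c13, yscZ19s6_c14, yscZ19s6_c15, yscZ19s6_c16, yscZ19s6_c17, yscZ19s6_c18, yscZ19s6_c19, yscZ19s6_c20, yscZ19s6_c21, yscZ19s6_c22, yscZ19s6_c23, yscZ19s6_cv24, yscZ19s6_cv25, yscZ19s6_cv26, yscZ19s6_cv27, yscZ19s6_cv28, yscZ19s6_cv29, yscZ19s6_cv30, yscZ19s6_cv31, yscZ19s6_cv32, yscZ19s6_cv33, yscZ19s6_cv34, yscZ19s6_cv35, yscZ19s6_c36, yscZ19s6_c37, yscZ19s6_c38, yscZ19s6_c39, yscZ19s6_c40, yscZ19s6_c41, yscZ19s6_c42, yscZ19s6_c43, yscZ19s6_c44,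 yscZ19s6_c45, yscZ19s6_c46, yscZ19s6_c47, yscZ19s6_cv48, yscZ19s6_cv49, yscZ19s6_cv50, yscZ19s6_cv51, yscZ19s6_cv52, yscZ19s6_cv53, yscZ19s6_cv54, yscZ19s6_cv55, yscZ19s6_cv56, yscZ19s6_cv57, yscZ19s6_cv58, yscZ19s6_cv59, yscZ19s6_c60, yscZ19s6_c61, yscZ19s6_c62, yscZ19s6_c63, fun _ h => (List.not_mem_nil h).elim⟩
  intro k hk ys hys hf
  have := List.all_eq_true.1 (h k hk) ys hys
  rw [Bool.or_eq_true, hf] at this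
  rcases this with h0 | h0
  · simp at h0
  · rwa [List.contains_iff_mem] at h0

end ZpZpDomino

end Summit.MatrixMultiplication.OmegaCensus
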